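import Summits.CriticalPhenomena.PercolationContinuityZ3.Theorems.FK.InfiniteVolumeMonotone
import Summits.CriticalPhenomena.PercolationContinuityZ3.Theorems.FK.InfiniteVolumeMeasures
import Summits.CriticalPhenomena.PercolationContinuityZ3.Theorems.FK.InfiniteVolumeBoxLaws
import Summits.CriticalPhenomena.PercolationContinuityZ3.Theorems.FK.BoxLimitComparison
import Literature.Probability.LatticeModels.RandomClusterContinuity
import Literature.Probability.Percolation.SharpnessDCTProofs
import HarnessLib

/-!
# FK-continuity cell, FO-10a: Grimmett 2006, Prop. (4.28) IN THE `q`-DIRECTION — `q ↦ φ¹_{p,q}(A)` is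
# left-continuous and `q ↦ φ⁰_{p,q}(A)` right-continuous on `[1,∞)`, for every increasing local event `A`

Registered R92 (cell INBOX l.6438, 2026-08-24); registry row FO-10a-g338q; label KAQ-A (coordinator fk-4 g195).
Cell `fk-continuity` (bschramm), row FO-10a; support file for the FK-continuity transplant
(`--supports stmt-CriticalPhenomena-4575`); builds on p205010 (kernel theorem, internal audit signed;
external expert review pending). Pure proofs; no definitions, no named facts, no sorries.

The `q`-mirror of `BoxLimitSemicontinuity.lean` (which treats `p`): the finite-volume probabilities `φ^b_{Λ_n,p,q}(A)` are
continuous in `q > 0` (a quotient of polynomials in `q`); `φ¹_{p,q}(A) ≤ φ¹_{Λ_n,p,q}(A) → φ¹_{p,q}(A)` makes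
`q ↦ φ¹_{p,q}(A)` upper semicontinuous and `φ⁰_{Λ_n,p,q}(A) ≤ φ⁰_{p,q}(A)` makes `q ↦ φ⁰_{p,q}(A)` lower semicontinuous
on `[1,∞)`; both are non-increasing in `q` (Prop. (4.28)(a), `rcLimit_real_anti_right`), so the first is LEFT- and the
second RIGHT-continuous in `q` (the directions are swapped with respect to `p` because the measures decrease in `q`).
This is the ingredient Grimmett's proof of Lemma (4.79) "⇐" takes from Prop. (4.28).

* `continuousWithinAt_Icc_of_antitoneOn_of_usc`, `continuousWithinAt_Ici_of_antitoneOn_of_lsc` (real analysis);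
* `continuousOn_rcMeasure_real_right`, `continuousOn_rcBoxLaw_real_right` — continuity in `q ∈ (0,∞)` of the
  finite-volume / box-law probabilities;
* `eventually_rcLimit_true_real_lt_right`, `continuousWithinAt_Icc_rcLimit_true_real_right`,
  **`tendsto_rcLimit_true_real_nhdsLT_right`** — `φ¹_{p,q'}(A) → φ¹_{p,q}(A)` as `q' ↑ q` (`q > 1`, `d ≥ 1`);
* `eventually_lt_rcLimit_false_real_right`, `continuousWithinAt_Ici_rcLimit_false_real_right`,
  **`tendsto_rcLimit_false_real_nhdsGT_right`** — `φ⁰_{p,q'}(A) → φ⁰_{p,q}(A)` as `q' ↓ q` (`q ≥ 1`).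

## References
* G. Grimmett, *The Random-Cluster Model*, Springer 2006 (`book:grimmett2006-random-cluster-model`): Prop. (4.28)
  and its proof [PDF pp. 79–80]; proof of Lemma (4.79) [p. 95]. [Grimmett2006]
-/

noncomputable section

open Filter Topology MeasureTheory

namespace Summit.CriticalPhenomena.PercolationContinuityZ3.Theorems.FK

open Literature.Probability.Percolation Literature.Probability.LatticeModels

/-! ### Real analysis: antitone + semicontinuous ⇒ one-sided continuous -/

section Real

/-- A function non-increasing on `[a,∞)` and upper semicontinuous within `[a,∞)` at `x ≥ a` is continuous from the
LEFT at `x` (within `[a,x]`). [folklore] -/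
theorem continuousWithinAt_Icc_of_antitoneOn_of_usc {f : ℝ → ℝ} {a x : ℝ} (hf : AntitoneOn f (Set.Ici a))
    (hx : a ≤ x) (husc : ∀ y, f x < y → ∀ᶠ t in 𝓝[Set.Ici a] x, f t < y) :
    ContinuousWithinAt f (Set.Icc a x) x := by
  rw [ContinuousWithinAt, tendsto_order]
  refine ⟨fun y hy => ?_, fun y hy => ?_⟩
  · filter_upwards [self_mem_nhdsWithin] with t ht
    exact hy.trans_le (hf (Set.mem_Ici.2 ht.1) (Set.mem_Ici.2 hx) ht.2)
  · exact (husc y hy).filter_mono (nhdsWithin_mono x fun t ht => Set.mem_Ici.2 ht.1)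

/-- A function non-increasing on `[a,∞)` and lower semicontinuous within `[a,∞)` at `x ≥ a` is continuous from the
RIGHT at `x` (within `[x,∞)`). [folklore] -/
theorem continuousWithinAt_Ici_of_antitoneOn_of_lsc {f : ℝ → ℝ} {a x : ℝ} (hf : AntitoneOn f (Set.Ici a))
    (hx : a ≤ x) (hlsc : ∀ y, y < f x → ∀ᶠ t in 𝓝[Set.Ici a] x, y < f t) :
    ContinuousWithinAt f (Set.Ici x) x := by
  rw [ContinuousWithinAt, tendsto_order]
  refine ⟨fun y hy => ?_, fun y hy => ?_⟩
  · exact (hlsc y hy).filter_mono (nhdsWithin_mono x fun t ht => Set.mem_Ici.2 (hx.trans ht))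
  · filter_upwards [self_mem_nhdsWithin] with t ht
    exact (hf (Set.mem_Ici.2 hx) (Set.mem_Ici.2 (hx.trans ht)) ht).trans_lt hy

end Real

/-! ### The finite-volume probabilities are continuous in `q` -/

section BoxLaw

variable {V : Type*} [Fintype V] [DecidableEq V] (G : SimpleGraph V) [DecidableRel G.Adj]

/-- **`q ↦ φ^B_{G,p,q}(A)` is continuous on `(0,∞)`** (`0 ≤ p ≤ 1`; a quotient of polynomials in `q`).
[cite: Grimmett2006, §1.2 eq. (1.2); proof of Thm. (4.58) (continuity)] -/
theorem continuousOn_rcMeasure_real_right {p : ℝ} (hp : p ∈ Set.Icc (0 : ℝ) 1) (B : Set V)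
    (A : Set (BondConfig V)) :
    ContinuousOn (fun q : ℝ => (rcMeasure G p q B).real A) (Set.Ioi 0) := by
  classical
  set f : ℝ → ℝ := fun q =>
    (∑ ω ∈ G.edgeFinset.powerset, if (↑ω : BondConfig V) ∈ A then rcWeight G p q B ω else 0) /
      rcPartitionFunction G p q B with hf
  have hw : ∀ ω : Finset (Sym2 V), Continuous fun q : ℝ => rcWeight G p q B ω := fun ω => by
    unfold rcWeight; fun_prop
  have hcont : ContinuousOn f (Set.Ioi 0) := by
    refine ContinuousOn.div ?_ ?_ ?_
    · refine Continuous.continuousOn (continuous_finsetSum _ fun ω _ => ?_)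
      split_ifs
      · exact hw ω
      · exact continuous_const
    · refine Continuous.continuousOn ?_
      unfold rcPartitionFunction
      exact continuous_finsetSum _ fun ω _ => hw ω
    · intro q hq
      exact (rcPartitionFunction_pos G hp hq B).ne'
  refine hcont.congr fun q hq => ?_
  rw [hf]
  dsimp only
  rw [rcMeasure_real_apply G hp hq B A, Finset.sum_div]
  exact Finset.sum_congr rfl fun ω _ => by split_ifs <;> simp

variable {d : ℕ}

/-- **`q ↦ φ^b_{Λ_n,p,q}(A)` is continuous on `(0,∞)`.** [cite: Grimmett2006, proof of Prop. (4.28)(b)] -/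
theorem continuousOn_rcBoxLaw_real_right (b : Bool) {p : ℝ} (hp : p ∈ Set.Icc (0 : ℝ) 1) (n : ℕ)
    {A : Set (BondConfig (Site d))} (hA : MeasurableSet A) :
    ContinuousOn (fun q : ℝ => (rcBoxLaw d b p q n).real A) (Set.Ioi 0) := by
  simp_rw [rcBoxLaw_real_apply b p _ n hA, rcBoxMeasure]
  exact continuousOn_rcMeasure_real_right _ hp _ _

end BoxLaw

/-! ### `q ↦ φ¹_{p,q}(A)`: upper semicontinuous and left-continuous on `[1,∞)` -/

section Wired

variable {d : ℕ} {p : ℝ} {A : Set (BondConfig (Site d))} {F : Finset (Sym2 (Site d))}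

/-- **Upper semicontinuity of `q ↦ φ¹_{p,q}(A)` within `[1,∞)`** for an increasing local event `A` (`d ≥ 1`):
`φ¹_{p,q}(A) ≤ φ¹_{Λ_n,p,q}(A)` for every `n`, the right side continuous in `q` and `→ φ¹_{p,q₀}(A)` at `q₀`.
[cite: Grimmett2006, Prop. (4.28)(b), mutatis mutandis in q] -/
theorem eventually_rcLimit_true_real_lt_right (hd : 0 < d) (hp : p ∈ Set.Icc (0 : ℝ) 1) (hA : DeterminedBy A ↑F)
    (hAu : IsUpperSet A) {q₀ : ℝ} (hq₀ : 1 ≤ q₀) {y : ℝ} (hy : (rcLimit d true p q₀).real A < y) :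
    ∀ᶠ q in 𝓝[Set.Ici 1] q₀, (rcLimit d true p q).real A < y := by
  have hAl : IsLocalEvent A := ⟨F, hA⟩
  obtain ⟨n₀, hn₀⟩ := DCT16.exists_subset_box (F.biUnion fun e => e.toFinset)
  have hF : ∀ n, n₀ ≤ n → ∀ e ∈ F, ∀ z ∈ e, z ∈ box d n := fun n hn e he z hz =>
    box_mono d hn (hn₀ (Finset.mem_biUnion.2 ⟨e, he, Sym2.mem_toFinset.2 hz⟩))
  have hlim := (isBoxLimit_rcLimit true hp hq₀).tendsto_real hAl
  obtain ⟨n, hn, hny⟩ : ∃ n, n₀ ≤ n ∧ (rcBoxLaw d true p q₀ n).real A < y := by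
    have h := (tendsto_order.1 hlim).2 y hy
    obtain ⟨n, hn⟩ := (h.and (eventually_ge_atTop n₀)).exists
    exact ⟨n, hn.2, hn.1⟩
  have hcont : ContinuousWithinAt (fun q : ℝ => (rcBoxLaw d true p q n).real A) (Set.Ici 1) q₀ :=
    ((continuousOn_rcBoxLaw_real_right true hp n (measurableSet_of_isLocalEvent_holds hAl)).mono
      fun q hq => one_pos.trans_le (Set.mem_Ici.1 hq)) q₀ (Set.mem_Ici.2 hq₀)
  have hev : ∀ᶠ q in 𝓝[Set.Ici 1] q₀, (rcBoxLaw d true p q n).real A < y := (tendsto_order.1 hcont).2 y hny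
  filter_upwards [hev, self_mem_nhdsWithin] with q hq hqI
  exact (rcLimit_real_le_rcBoxLaw hd hp (Set.mem_Ici.1 hqI) hA hAu (hF n hn)).trans_lt hq

/-- **`q ↦ φ¹_{p,q}(A)` is LEFT-continuous on `[1,∞)`** for every increasing local event `A` (`d ≥ 1`): non-increasing
(Prop. (4.28)(a)) and upper semicontinuous. [cite: Grimmett2006, Prop. (4.28), in q] -/
theorem continuousWithinAt_Icc_rcLimit_true_real_right (hd : 0 < d) (hp : p ∈ Set.Icc (0 : ℝ) 1)
    (hA : DeterminedBy A ↑F) (hAu : IsUpperSet A) {q₀ : ℝ} (hq₀ : 1 ≤ q₀) :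
    ContinuousWithinAt (fun q : ℝ => (rcLimit d true p q).real A) (Set.Icc 1 q₀) q₀ := by
  refine continuousWithinAt_Icc_of_antitoneOn_of_usc (a := 1) ?_ hq₀ fun y hy =>
    eventually_rcLimit_true_real_lt_right hd hp hA hAu hq₀ hy
  intro q₁ hq₁ q₂ hq₂ h12
  exact rcLimit_real_anti_right true (exists_isBoxLimit true hp (le_trans hq₁ h12)) (exists_isBoxLimit true hp hq₁) hp
    hq₁ h12 hAu hA

/-- The same as a one-sided limit: `φ¹_{p,q}(A) → φ¹_{p,q₀}(A)` as `q ↑ q₀`, `q₀ > 1`. [cite: Grimmett2006, Prop. (4.28), in q] -/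
theorem tendsto_rcLimit_true_real_nhdsLT_right (hd : 0 < d) (hp : p ∈ Set.Icc (0 : ℝ) 1) (hA : DeterminedBy A ↑F)
    (hAu : IsUpperSet A) {q₀ : ℝ} (hq₀ : 1 < q₀) :
    Tendsto (fun q : ℝ => (rcLimit d true p q).real A) (𝓝[<] q₀) (𝓝 ((rcLimit d true p q₀).real A)) := by
  have h := continuousWithinAt_Icc_rcLimit_true_real_right hd hp hA hAu hq₀.le
  rw [ContinuousWithinAt] at h
  rw [← nhdsWithin_Ico_eq_nhdsLT hq₀]
  exact h.mono_left (nhdsWithin_mono _ Set.Ico_subset_Icc_self)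

end Wired

/-! ### `q ↦ φ⁰_{p,q}(A)`: lower semicontinuous and right-continuous on `[1,∞)` -/

section Free

variable {d : ℕ} {p : ℝ} {A : Set (BondConfig (Site d))} {F : Finset (Sym2 (Site d))}

/-- **Lower semicontinuity of `q ↦ φ⁰_{p,q}(A)` within `[1,∞)`** for an increasing local event `A`:
`φ⁰_{Λ_n,p,q}(A) ≤ φ⁰_{p,q}(A)`, the left side continuous in `q` and `→ φ⁰_{p,q₀}(A)` at `q₀`.
[cite: Grimmett2006, Prop. (4.28)(c), mutatis mutandis in q] -/
theorem eventually_lt_rcLimit_false_real_right (hp : p ∈ Set.Icc (0 : ℝ) 1) (hA : DeterminedBy A ↑F)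
    (hAu : IsUpperSet A) {q₀ : ℝ} (hq₀ : 1 ≤ q₀) {y : ℝ} (hy : y < (rcLimit d false p q₀).real A) :
    ∀ᶠ q in 𝓝[Set.Ici 1] q₀, y < (rcLimit d false p q).real A := by
  have hAl : IsLocalEvent A := ⟨F, hA⟩
  have hlim := (isBoxLimit_rcLimit false hp hq₀).tendsto_real hAl
  obtain ⟨n, hny⟩ : ∃ n, y < (rcBoxLaw d false p q₀ n).real A := ((tendsto_order.1 hlim).1 y hy).exists
  have hcont : ContinuousWithinAt (fun q : ℝ => (rcBoxLaw d false p q n).real A) (Set.Ici 1) q₀ :=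
    ((continuousOn_rcBoxLaw_real_right false hp n (measurableSet_of_isLocalEvent_holds hAl)).mono
      fun q hq => one_pos.trans_le (Set.mem_Ici.1 hq)) q₀ (Set.mem_Ici.2 hq₀)
  have hev : ∀ᶠ q in 𝓝[Set.Ici 1] q₀, y < (rcBoxLaw d false p q n).real A := (tendsto_order.1 hcont).1 y hny
  filter_upwards [hev, self_mem_nhdsWithin] with q hq hqI
  exact hq.trans_le (rcBoxLaw_real_le_rcLimit hp (Set.mem_Ici.1 hqI) hAl hAu n)

/-- **`q ↦ φ⁰_{p,q}(A)` is RIGHT-continuous on `[1,∞)`** for every increasing local event `A`: non-increasing and lower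
semicontinuous. [cite: Grimmett2006, Prop. (4.28), in q] -/
theorem continuousWithinAt_Ici_rcLimit_false_real_right (hp : p ∈ Set.Icc (0 : ℝ) 1) (hA : DeterminedBy A ↑F)
    (hAu : IsUpperSet A) {q₀ : ℝ} (hq₀ : 1 ≤ q₀) :
    ContinuousWithinAt (fun q : ℝ => (rcLimit d false p q).real A) (Set.Ici q₀) q₀ := by
  refine continuousWithinAt_Ici_of_antitoneOn_of_lsc (a := 1) ?_ hq₀ fun y hy =>
    eventually_lt_rcLimit_false_real_right hp hA hAu hq₀ hy
  intro q₁ hq₁ q₂ hq₂ h12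
  exact rcLimit_real_anti_right false (exists_isBoxLimit false hp (le_trans hq₁ h12)) (exists_isBoxLimit false hp hq₁) hp
    hq₁ h12 hAu hA

/-- The same as a one-sided limit: `φ⁰_{p,q}(A) → φ⁰_{p,q₀}(A)` as `q ↓ q₀`, `q₀ ≥ 1`. [cite: Grimmett2006, Prop. (4.28), in q] -/
theorem tendsto_rcLimit_false_real_nhdsGT_right (hp : p ∈ Set.Icc (0 : ℝ) 1) (hA : DeterminedBy A ↑F)
    (hAu : IsUpperSet A) {q₀ : ℝ} (hq₀ : 1 ≤ q₀) :
    Tendsto (fun q : ℝ => (rcLimit d false p q).real A) (𝓝[>] q₀) (𝓝 ((rcLimit d false p q₀).real A)) := by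
  have h := continuousWithinAt_Ici_rcLimit_false_real_right hp hA hAu hq₀
  rw [ContinuousWithinAt] at h
  exact h.mono_left (nhdsWithin_mono _ Set.Ioi_subset_Ici_self)

end Free

end Summit.CriticalPhenomena.PercolationContinuityZ3.Theorems.FK

end
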